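import Literature.GroupTheory.Coxeter.ReflectionSubgroups
import HarnessLib

/-!
# `|N(g)| = ℓ(g)` and Dyer's minimal coset representatives for a reflection subgroup (Dyer 1990 Lemma 2.3 (ii), Corollary 3.4 (ii))

Layer `Literature/GroupTheory/Coxeter`, namespace `Literature.GroupTheory.Coxeter`; lane `lit-hodgefound` (Track 2 foundations library; prover seat p13,
generation 30, seventh file — over `ReflectionCocycle` (Dyer's cocycle `N`, `ℓ(tg) < ℓ(g) ⟺ t ∈ N(g)`, the reflection sequence `t_i` of a word) and
`ReflectionSubgroups` (canonical generators `χ(G₁)`, the Coxeter system `(G₁, χ(G₁))` of a reflection subgroup with cocycle `N ∩ G₁`)).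

For a pre-Coxeter system `h : IsPreCoxeterSystem s` with reflection cocycle `hN : IsReflectionCocycle s N`:

* ★★ **Dyer's Lemma 2.3 (ii) for involutions ∕ Björner–Brenti Cor 1.4.5: for a reduced word, `N(s_{b₁}⋯s_{b_k}) = {t_1, …, t_k}` with the `t_i` pairwise distinct,
  hence `N(g)` is finite and `|N(g)| = ℓ(g)`** (`apply_wordProd_eq_of_isReduced`, `nodup_leftReflSeq_of_isReduced`, `ncard_apply_eq_length`);
* a nontrivial element is shortened on the left by some generator (`exists_length_simple_mul_lt`);
* ★★★ **Dyer's Corollary 3.4 (ii): for a reflection subgroup `G₁ = ⟨G₁ ∩ T⟩` and any `x`, the coset `G₁x` contains a UNIQUE element `x₀` with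
  `N(x₀) ∩ G₁ = ∅`; it is the unique element of minimal length of `G₁x`; and for `g ∈ G₁`, `N(gx₀) ∩ G₁ = N(g) ∩ G₁` and `ℓ(gx₀) ≥ ℓ(x₀) + ℓ₁(g)`**
  (`ℓ₁` the length of the Coxeter system `(G₁, χ(G₁))`): `apply_inter_eq_empty_of_minimal`, `apply_mul_inter_eq`, `length_add_length_le_length_mul`,
  `eq_of_apply_inter_eq_empty`, `existsUnique_apply_inter_eq_empty`, `existsUnique_minimal_length`;
* the same for a Mathlib Coxeter system of any rank and a subgroup `W'` generated by reflections (`CoxeterSystem.existsUnique_coset_repr_of_reflection_subgroup`).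

PROVED theorems only (no definition, no named fact, no `sorry`: net debt 0); no instance, no notation.

## Source, verbatim

M. Dyer, *Reflection subgroups of Coxeter systems*, J. Algebra **135** (1990) 57–73 [Dyer1990] (fetched `paper:doi-10-1016-0021-8693-90-90149-i`, pp. 59,
64–65): «**(2.3) Lemma.** (i) Any `g ∈ G` has a strongly reduced expression. (ii) For `g ∈ G`, `l_1(g) = #{t ∈ T | mult_t(g) ≠ 0}` and `l(g) = Σ_{t ∈ T} ‖mult_t(g)‖`.
… (2.4) implies that the `t_i` are pairwise distinct … **(3.4) Corollary.** Suppose `(G_1, X_1) ≤ (G, X)`. (i) … (ii) For any `h ∈ G`, the coset `G_1h` has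
a unique element `h_0` of minimal length `l(h_0)`. For any `g ∈ G_1` and `t ∈ G_1 ∩ T`, `mult_t(gh_0) = mult_t(g)`. *Proof.* … let `h_0` be an element of
`G_1h` with `l(h_0)` minimal. Then `l(t^εh_0) > l(h_0)` for all `t ∈ G_1 ∩ T` and `ε ∈ {±1}`, so Lemma 2.3(iii) implies `mult_t(h_0) = 0` for all
`t ∈ G_1 ∩ T`, i.e., `N(h_0) ∩ G_1 = 0`. The claim `mult_t(gh_0) = mult_t(g)` follows from (2.2). Finally, this last fact together with (i) shows that for
`g ∈ G_1`, `l(gh_0) − l(h_0) ≥ l'(g)` so `h_0` is the unique element of `G_1h` of minimal length.»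

A. Björner, F. Brenti, *Combinatorics of Coxeter Groups* (2005) [BjornerBrenti2005], §1.4 Corollary 1.4.5 («`ℓ(w) = |T_L(w)|`»).

## Proof notes

`N(π ω) ⊆ {t_i}` is (2.4); conversely `t_i · π ω = π(ω ∖ i)` is shorter, so `t_i ∈ N(π ω)` by 2.3 (iii); if `t_i = t_j` (`i < j`) then `π ω = t_it_j · π ω` is the
product of `ω` with two letters deleted, contradicting reducedness.  For 3.4 (ii), `ℓ(gx₀) ≥ ℓ(x₀) + ℓ₁(g)` is proved by induction on `ℓ₁(g)` along a reduced
word of `g` in the canonical generators, each letter lying in `N(gx₀) ∩ G₁ = N(g) ∩ G₁`.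
-/

open scoped symmDiff Pointwise

namespace Literature.GroupTheory.Coxeter

variable {B W : Type*} [Group W] {s : B → W}

namespace PreCoxeterSystem

/-! ### §1 `N` of a reduced word; `|N(g)| = ℓ(g)` -/

/-- Deleting a later letter does not change `t_i`: for `i < j`, `t_i(ω ∖ j) = t_i(ω)`. [cite: Dyer1990, §2 (2.4)] -/
theorem getElem_leftReflSeq_eraseIdx_of_lt (ω : List B) {i j : ℕ} (hij : i < j)
    (hi : i < (leftReflSeq s (ω.eraseIdx j)).length) (hi' : i < (leftReflSeq s ω).length) :
    (leftReflSeq s (ω.eraseIdx j))[i] = (leftReflSeq s ω)[i] := by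
  rw [getElem_leftReflSeq, getElem_leftReflSeq, List.take_eraseIdx_eq_take_of_le ω i j hij.le]
  congr 2
  rw [List.getElem_eraseIdx_of_lt]
  exact hij

/-- ★ **For a reduced word, `N(s_{b₁}⋯s_{b_k}) = {t_1, …, t_k}`.** [cite: Dyer1990, §2 Lemma 2.3 (ii), proof («`{t ∈ T | mult_t(g) ≠ 0} = {t_1, …, t_m}`»)]
[cite: BjornerBrenti2005, §1.4 Corollary 1.4.4] -/
theorem IsReflectionCocycle.apply_wordProd_eq_of_isReduced (h : IsPreCoxeterSystem s) {N : W → Set W} (hN : IsReflectionCocycle s N) {ω : List B}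
    (hω : IsReduced s ω) : N (wordProd s ω) = {t | t ∈ leftReflSeq s ω} := by
  ext t
  refine ⟨fun ht => hN.mem_leftReflSeq_of_mem ht, fun ht => ?_⟩
  obtain ⟨i, hi, rfl⟩ := List.getElem_of_mem ht
  rw [← hN.length_mul_lt_iff_mem h (mem_reflections_of_mem_leftReflSeq ht), getElem_leftReflSeq_mul_wordProd h.mul_self ω i hi, hω.length_eq]
  refine (length_wordProd_le s _).trans_lt ?_
  rw [length_leftReflSeq] at hi
  rw [List.length_eraseIdx_of_lt hi]
  omega

/-- ★ **For a reduced word the `t_i` are pairwise distinct** («(2.4) implies that the `t_i` are pairwise distinct»). [cite: Dyer1990, §2 proof of Lemma 2.3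
(«(2.4) implies that the `t_i` are pairwise distinct»)] [cite: BjornerBrenti2005, §1.4 Lemma 1.4.2 / Corollary 1.4.5] -/
theorem nodup_leftReflSeq_of_isReduced (h : IsPreCoxeterSystem s) {ω : List B} (hω : IsReduced s ω) : (leftReflSeq s ω).Nodup := by
  rw [List.nodup_iff_getElem?_ne_getElem?]
  intro i j hij hj heq
  have hi : i < (leftReflSeq s ω).length := hij.trans hj
  rw [List.getElem?_eq_getElem hi, List.getElem?_eq_getElem hj, Option.some.injEq] at heq
  rw [length_leftReflSeq] at hi hj
  -- `π ω = t_i t_j · π ω = t_i · π (ω ∖ j) = π ((ω ∖ j) ∖ i)`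
  have hti : (leftReflSeq s ω)[i] * (leftReflSeq s ω)[i] = 1 :=
    mul_self_of_mem_reflections h.mul_self (mem_reflections_of_mem_leftReflSeq (List.getElem_mem _))
  have hi2 : i < (leftReflSeq s (ω.eraseIdx j)).length := by
    rw [length_leftReflSeq, List.length_eraseIdx_of_lt hj]; omega
  have e : wordProd s ω = wordProd s ((ω.eraseIdx j).eraseIdx i) := by
    calc wordProd s ω = (leftReflSeq s ω)[i] * ((leftReflSeq s ω)[j] * wordProd s ω) := by rw [← heq, ← mul_assoc, hti, one_mul]
      _ = (leftReflSeq s ω)[i] * wordProd s (ω.eraseIdx j) := by rw [getElem_leftReflSeq_mul_wordProd h.mul_self ω j (by simpa using hj)]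
      _ = (leftReflSeq s (ω.eraseIdx j))[i] * wordProd s (ω.eraseIdx j) := by
          rw [getElem_leftReflSeq_eraseIdx_of_lt ω hij hi2 (by simpa using hi)]
      _ = wordProd s ((ω.eraseIdx j).eraseIdx i) := getElem_leftReflSeq_mul_wordProd h.mul_self _ i hi2
  have h1 := length_wordProd_le s ((ω.eraseIdx j).eraseIdx i)
  rw [← e, hω.length_eq] at h1
  have h2 := length_eraseIdx_eraseIdx (ω := ω) hij hj
  omega

/-- ★★ **`N(g)` is finite and `|N(g)| = ℓ(g)`** (Dyer 2.3 (ii): «`l_1(g) = #{t ∈ T | mult_t(g) ≠ 0}`»; Björner–Brenti: `ℓ(w) = |T_L(w)|`).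
[cite: Dyer1990, §2 Lemma 2.3 (ii)] [cite: BjornerBrenti2005, §1.4 Corollary 1.4.5] -/
theorem IsReflectionCocycle.ncard_apply_eq_length (h : IsPreCoxeterSystem s) {N : W → Set W} (hN : IsReflectionCocycle s N) (g : W) :
    (N g).ncard = length s g := by
  classical
  obtain ⟨ω, hω, rfl⟩ := h.exists_isReduced g
  rw [hN.apply_wordProd_eq_of_isReduced h hω, ← List.coe_toFinset, Set.ncard_coe_finset,
    List.toFinset_card_of_nodup (nodup_leftReflSeq_of_isReduced h hω), length_leftReflSeq, hω.length_eq]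

/-- `N(g)` is a finite set. [cite: Dyer1990, §2 Definition 2.1 («almost all `a_t = 0`»), Lemma 2.3 (ii)] -/
theorem IsReflectionCocycle.finite_apply (h : IsPreCoxeterSystem s) {N : W → Set W} (hN : IsReflectionCocycle s N) (g : W) : (N g).Finite := by
  obtain ⟨ω, hω, rfl⟩ := h.exists_isReduced g
  rw [hN.apply_wordProd_eq_of_isReduced h hω]
  exact (leftReflSeq s ω).finite_toSet

/-- `N(g) = ∅ ⟺ g = 1`. [cite: Dyer1990, §2 Lemma 2.3 (ii)] -/
theorem IsReflectionCocycle.apply_eq_empty_iff (h : IsPreCoxeterSystem s) {N : W → Set W} (hN : IsReflectionCocycle s N) (g : W) :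
    N g = ∅ ↔ g = 1 := by
  rw [← h.length_eq_zero_iff, ← hN.ncard_apply_eq_length h g, Set.ncard_eq_zero (hN.finite_apply h g)]

end PreCoxeterSystem

namespace IsPreCoxeterSystem

open PreCoxeterSystem

/-- A nontrivial element is shortened on the left by some generator (the first letter of a reduced word). [cite: Dyer1990, §3 proof of Corollary 3.4]
[cite: BjornerBrenti2005, §1.4 Corollary 1.4.6] -/
theorem exists_length_simple_mul_lt (h : IsPreCoxeterSystem s) {g : W} (hg : g ≠ 1) : ∃ b, length s (s b * g) < length s g := by
  obtain ⟨ω, hω, rfl⟩ := h.exists_isReduced g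
  obtain ⟨b, ω', rfl⟩ : ∃ b ω', ω = b :: ω' := by
    rcases ω with _ | ⟨b, ω'⟩
    · exact absurd (wordProd_nil s) hg
    · exact ⟨b, ω', rfl⟩
  refine ⟨b, ?_⟩
  have h1 := hω.length_eq
  rw [wordProd_cons, List.length_cons] at h1
  rw [wordProd_cons, h.simple_mul_simple_mul, h1]
  exact Nat.lt_succ_of_le (length_wordProd_le s ω')

end IsPreCoxeterSystem

namespace PreCoxeterSystem

namespace IsReflectionCocycle

variable {N : W → Set W}

/-! ### §2 Corollary 3.4 (ii): the element `x₀` of `G₁x` with `N(x₀) ∩ G₁ = ∅` -/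

/-- **An element of minimal length in its coset `G₁x₀` has `N(x₀) ∩ G₁ = ∅`** («`l(t^εh_0) > l(h_0)` for all `t ∈ G_1 ∩ T` … so … `N(h_0) ∩ G_1 = 0`»; for
any subgroup `G₁`). [cite: Dyer1990, §3 proof of Corollary 3.4 (ii)] -/
theorem apply_inter_eq_empty_of_minimal (h : IsPreCoxeterSystem s) (hN : IsReflectionCocycle s N) (G₁ : Subgroup W) {x₀ : W}
    (hmin : ∀ y : W, y * x₀⁻¹ ∈ G₁ → length s x₀ ≤ length s y) : N x₀ ∩ (G₁ : Set W) = ∅ := by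
  ext t
  simp only [Set.mem_inter_iff, SetLike.mem_coe, Set.mem_empty_iff_false, iff_false, not_and]
  intro htN htG
  have ht : t ∈ reflections s := hN.subset_reflections h x₀ htN
  have h1 := (hN.length_mul_lt_iff_mem h ht x₀).2 htN
  have h2 := hmin (t * x₀) (by rwa [mul_assoc, mul_inv_cancel, mul_one])
  omega

/-- **Existence of a minimal-length element in every coset `G₁x`.** [cite: Dyer1990, §3 proof of Corollary 3.4 (ii) («let `h_0` be an element of `G_1h` with
`l(h_0)` minimal»)] -/
theorem exists_minimal_length (G₁ : Subgroup W) (x : W) :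
    ∃ x₀ : W, x₀ * x⁻¹ ∈ G₁ ∧ ∀ y : W, y * x⁻¹ ∈ G₁ → length s x₀ ≤ length s y := by
  classical
  have hex : ∃ n, ∃ y : W, y * x⁻¹ ∈ G₁ ∧ length s y = n := ⟨_, x, by simp, rfl⟩
  obtain ⟨x₀, hx₀, hlen⟩ := Nat.find_spec hex
  refine ⟨x₀, hx₀, fun y hy => ?_⟩
  rw [hlen]
  exact Nat.find_min' hex ⟨y, hy, rfl⟩

/-- ★ **Existence: every coset `G₁x` contains an element `x₀` with `N(x₀) ∩ G₁ = ∅`** (any subgroup `G₁`). [cite: Dyer1990, §3 Corollary 3.4 (ii)] -/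
theorem exists_apply_inter_eq_empty (h : IsPreCoxeterSystem s) (hN : IsReflectionCocycle s N) (G₁ : Subgroup W) (x : W) :
    ∃ x₀ : W, x₀ * x⁻¹ ∈ G₁ ∧ N x₀ ∩ (G₁ : Set W) = ∅ := by
  obtain ⟨x₀, hx₀, hmin⟩ := exists_minimal_length (s := s) G₁ x
  refine ⟨x₀, hx₀, hN.apply_inter_eq_empty_of_minimal h G₁ fun y hy => hmin y ?_⟩
  have : y * x₀⁻¹ * (x₀ * x⁻¹) ∈ G₁ := G₁.mul_mem hy hx₀
  simpa [mul_assoc] using this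

/-- ★ **`N(gx₀) ∩ G₁ = N(g) ∩ G₁` for `g ∈ G₁` when `N(x₀) ∩ G₁ = ∅`** («The claim `mult_t(gh_0) = mult_t(g)` follows from (2.2)»). [cite: Dyer1990, §3
Corollary 3.4 (ii)] -/
theorem apply_mul_inter_eq (hN : IsReflectionCocycle s N) {G₁ : Subgroup W} {g x₀ : W} (hg : g ∈ G₁) (hx₀ : N x₀ ∩ (G₁ : Set W) = ∅) :
    N (g * x₀) ∩ (G₁ : Set W) = N g ∩ (G₁ : Set W) := by
  rw [hN.apply_mul, Set.inter_symmDiff_distrib_right, ← conj_subgroup_eq hg, ← conj_inter, hx₀, conj_empty, conj_subgroup_eq hg]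
  simp

/-- ★★ **`ℓ(gx₀) ≥ ℓ(x₀) + ℓ₁(g)` for `g ∈ G₁`, `G₁` a reflection subgroup, `N(x₀) ∩ G₁ = ∅`** (`ℓ₁` the length of `(G₁, χ(G₁))`; «for `g ∈ G_1`,
`l(gh_0) − l(h_0) ≥ l'(g)`»). [cite: Dyer1990, §3 proof of Corollary 3.4 (ii)] -/
theorem length_add_length_le_length_mul (h : IsPreCoxeterSystem s) (hN : IsReflectionCocycle s N) {G₁ : Subgroup W}
    (hG : Subgroup.closure ((G₁ : Set W) ∩ reflections s) = G₁) {x₀ : W} (hx₀ : N x₀ ∩ (G₁ : Set W) = ∅) (g : G₁) :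
    length s x₀ + length (inclusion s N G₁) g ≤ length s ((g : W) * x₀) := by
  have h₁ := isPreCoxeterSystem_inclusion (G₁ := G₁) h hN hG
  have hN₁ := isReflectionCocycle_restrict (G₁ := G₁) (N := N) hN
  suffices H : ∀ (n : ℕ) (g : G₁), length (inclusion s N G₁) g = n → length s x₀ + n ≤ length s ((g : W) * x₀) from H _ g rfl
  intro n
  induction n with
  | zero =>
    intro g hg
    rw [h₁.length_eq_zero_iff] at hg
    subst hg
    simp
  | succ n ih =>
    intro g hg
    have hg1 : g ≠ 1 := fun e => by rw [e, length_one] at hg; exact Nat.succ_ne_zero n hg.symm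
    obtain ⟨t, ht⟩ := h₁.exists_length_simple_mul_lt hg1
    -- `t ∈ N₁(g) = N(g) ∩ G₁ = N(gx₀) ∩ G₁`, so `t` shortens `gx₀`
    have htN₁ : inclusion s N G₁ t ∈ restrict N G₁ g :=
      (hN₁.length_mul_lt_iff_mem h₁ (simple_mem_reflections _ t) g).1 ht
    rw [mem_restrict_iff, coe_inclusion] at htN₁
    have htN : (t : W) ∈ N ((g : W) * x₀) := by
      have : (t : W) ∈ N (g : W) ∩ (G₁ : Set W) := ⟨htN₁, canonicalGenerators_subset s N G₁ t.2⟩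
      rw [← hN.apply_mul_inter_eq g.2 hx₀] at this
      exact this.1
    have hlt := (hN.length_mul_lt_iff_mem h t.2.1 ((g : W) * x₀)).2 htN
    -- `ℓ₁(tg) = n`
    have hlen : length (inclusion s N G₁) (inclusion s N G₁ t * g) = n := by
      have h2 := h₁.length_le_length_simple_mul_add_one t g
      omega
    have h3 := ih (inclusion s N G₁ t * g) hlen
    rw [Subgroup.coe_mul, coe_inclusion, mul_assoc] at h3
    omega

/-- ★★ **Uniqueness: two elements of the same coset `G₁x` with `N(·) ∩ G₁ = ∅` are equal** (reflection subgroup `G₁`). [cite: Dyer1990, §3 Corollary 3.4 (ii)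
(«`h_0` is the unique element of `G_1h` of minimal length»)] -/
theorem eq_of_apply_inter_eq_empty (h : IsPreCoxeterSystem s) (hN : IsReflectionCocycle s N) {G₁ : Subgroup W}
    (hG : Subgroup.closure ((G₁ : Set W) ∩ reflections s) = G₁) {x₀ x₁ : W} (hx : x₁ * x₀⁻¹ ∈ G₁) (hx₀ : N x₀ ∩ (G₁ : Set W) = ∅)
    (hx₁ : N x₁ ∩ (G₁ : Set W) = ∅) : x₁ = x₀ := by
  have h₁ := isPreCoxeterSystem_inclusion (G₁ := G₁) h hN hG
  have hN₁ := isReflectionCocycle_restrict (G₁ := G₁) (N := N) hN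
  set g : G₁ := ⟨x₁ * x₀⁻¹, hx⟩ with hgdef
  have hx₁' : x₁ = (g : W) * x₀ := by simp [hgdef]
  have hNg : N (g : W) ∩ (G₁ : Set W) = ∅ := by rw [← hN.apply_mul_inter_eq g.2 hx₀, ← hx₁', hx₁]
  -- hence `N₁(g) = ∅`, so `g = 1`
  have hN₁g : restrict N G₁ g = ∅ := by
    ext u
    simp only [mem_restrict_iff, Set.mem_empty_iff_false, iff_false]
    intro hu
    have : (u : W) ∈ N (g : W) ∩ (G₁ : Set W) := ⟨hu, u.2⟩
    rw [hNg] at this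
    exact this
  have hg1 : g = 1 := (hN₁.apply_eq_empty_iff h₁ g).1 hN₁g
  rw [hx₁', hg1, Subgroup.coe_one, one_mul]

/-- ★★★ **Dyer's Corollary 3.4 (ii): every coset `G₁x` of a reflection subgroup contains a unique `x₀` with `N(x₀) ∩ G₁ = ∅`.** [cite: Dyer1990, §3
Corollary 3.4 (ii)] -/
theorem existsUnique_apply_inter_eq_empty (h : IsPreCoxeterSystem s) (hN : IsReflectionCocycle s N) {G₁ : Subgroup W}
    (hG : Subgroup.closure ((G₁ : Set W) ∩ reflections s) = G₁) (x : W) : ∃! x₀ : W, x₀ * x⁻¹ ∈ G₁ ∧ N x₀ ∩ (G₁ : Set W) = ∅ := by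
  obtain ⟨x₀, hx₀, hN₀⟩ := hN.exists_apply_inter_eq_empty h G₁ x
  refine ⟨x₀, ⟨hx₀, hN₀⟩, fun x₁ ⟨hx₁, hN₁⟩ => hN.eq_of_apply_inter_eq_empty h hG ?_ hN₀ hN₁⟩
  have : x₁ * x⁻¹ * (x₀ * x⁻¹)⁻¹ ∈ G₁ := G₁.mul_mem hx₁ (G₁.inv_mem hx₀)
  simpa [mul_assoc] using this

/-- ★★★ **Dyer's Corollary 3.4 (ii), as printed: the coset `G₁x` of a reflection subgroup has a unique element of minimal length.** [cite: Dyer1990, §3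
Corollary 3.4 (ii) («For any `h ∈ G`, the coset `G_1h` has a unique element `h_0` of minimal length `l(h_0)`»)] -/
theorem existsUnique_minimal_length (h : IsPreCoxeterSystem s) (hN : IsReflectionCocycle s N) {G₁ : Subgroup W}
    (hG : Subgroup.closure ((G₁ : Set W) ∩ reflections s) = G₁) (x : W) :
    ∃! x₀ : W, x₀ * x⁻¹ ∈ G₁ ∧ ∀ y : W, y * x⁻¹ ∈ G₁ → length s x₀ ≤ length s y := by
  obtain ⟨x₀, hx₀, hmin⟩ := exists_minimal_length (s := s) G₁ x
  have key : ∀ y : W, y * x⁻¹ ∈ G₁ → (∀ z : W, z * x⁻¹ ∈ G₁ → length s y ≤ length s z) → N y ∩ (G₁ : Set W) = ∅ := fun y hy hymin =>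
    hN.apply_inter_eq_empty_of_minimal h G₁ fun z hz => hymin z (by
      have : z * y⁻¹ * (y * x⁻¹) ∈ G₁ := G₁.mul_mem hz hy
      simpa [mul_assoc] using this)
  refine ⟨x₀, ⟨hx₀, hmin⟩, fun x₁ ⟨hx₁, hmin₁⟩ => hN.eq_of_apply_inter_eq_empty h hG ?_ (key x₀ hx₀ hmin) (key x₁ hx₁ hmin₁)⟩
  have : x₁ * x⁻¹ * (x₀ * x⁻¹)⁻¹ ∈ G₁ := G₁.mul_mem hx₁ (G₁.inv_mem hx₀)
  simpa [mul_assoc] using this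

/-- The distinguished representative is the minimal one: `N(x₀) ∩ G₁ = ∅` implies `ℓ(x₀) ≤ ℓ(y)` for all `y ∈ G₁x₀` (indeed `ℓ(gx₀) ≥ ℓ(x₀) + ℓ₁(g)`).
[cite: Dyer1990, §3 Corollary 3.4 (ii)] -/
theorem length_le_of_apply_inter_eq_empty (h : IsPreCoxeterSystem s) (hN : IsReflectionCocycle s N) {G₁ : Subgroup W}
    (hG : Subgroup.closure ((G₁ : Set W) ∩ reflections s) = G₁) {x₀ : W} (hx₀ : N x₀ ∩ (G₁ : Set W) = ∅) {y : W} (hy : y * x₀⁻¹ ∈ G₁) :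
    length s x₀ ≤ length s y := by
  have h1 := hN.length_add_length_le_length_mul h hG hx₀ ⟨y * x₀⁻¹, hy⟩
  simp only [inv_mul_cancel_right] at h1
  omega

end IsReflectionCocycle

end PreCoxeterSystem

/-! ### §3 For a Mathlib Coxeter system of any rank -/

section Mathlib

open PreCoxeterSystem

variable {M : CoxeterMatrix B} (cs : CoxeterSystem M W)

/-- ★★★ **Dyer's minimal coset representatives for a reflection subgroup `W'` of a Coxeter group (any rank): every coset `W'w` contains a unique `w₀`
none of whose left inversions lies in `W'`; it is the element of minimal length, and `ℓ(uw₀) ≥ ℓ(w₀)` for `u ∈ W'`.** [cite: Dyer1990, §3 Corollary 3.4 (ii)]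
[cite: Humphreys1990, §8.2] -/
theorem CoxeterSystem.existsUnique_coset_repr_of_reflection_subgroup (W' : Subgroup W)
    (hW' : Subgroup.closure ((W' : Set W) ∩ {t | cs.IsReflection t}) = W') (w : W) :
    ∃! w₀ : W, w₀ * w⁻¹ ∈ W' ∧ ∀ t ∈ W', ¬cs.IsLeftInversion w₀ t := by
  have hT : {t | cs.IsReflection t} = reflections cs.simple := by
    ext t; exact (mem_reflections_simple_iff cs t).symm
  rw [hT] at hW'
  have key : ∀ w₀ : W, (∀ t ∈ W', ¬cs.IsLeftInversion w₀ t) ↔ {t | cs.IsLeftInversion w₀ t} ∩ (W' : Set W) = ∅ := fun w₀ => by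
    rw [Set.eq_empty_iff_forall_notMem]
    simp only [Set.mem_inter_iff, Set.mem_setOf_eq, SetLike.mem_coe, not_and']
  simp only [key]
  exact (isReflectionCocycle_isLeftInversion cs).existsUnique_apply_inter_eq_empty (isPreCoxeterSystem_simple cs) hW' w

end Mathlib

end Literature.GroupTheory.Coxeter
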